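import Summits.CriticalPhenomena.PercolationContinuityZ3.Theses.PercNearOneGluing
import Summits.CriticalPhenomena.PercolationContinuityZ3.Theorems.PercNearOneGluingAdditiveGluingOffClusterAssociation
import HarnessLib

/-!
# Crux `PercNearOneGluing.AdditiveGluing` (stmt-CriticalPhenomena-4576), line `tieline`: attaching `c`'s cluster
# to `L = C_v` (3PT-f)

Support file (`--supports stmt-CriticalPhenomena-4576`, helper, lead c11).  No definitions, no named facts, no sorries.

Weighted graph on `Fin n` (`μ = prodBernoulli w`), relays `u, v`, observer `o`, spectator `c`; `D = {u ↮ v}`,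
`N = {c ↮ u} ∩ {c ↮ v}` ("`c` free of both clusters"), `L = C_v`.  Lemma (3PT-f) of the line: given `u ↮ v`,
conditioning on `c ∈ L` makes `o ∈ L` at least as likely as `o ∈ L ∪ C_c` is given `c` free,

  (3PT-f)  `P_D(o ↔ v | c ↔ v) ≥ P_D(o ↔ v or o ↔ c | c ↮ u, c ↮ v)`,  `P_D = P( · | u ↮ v)`,

in the division-free form `μ(D ∩ {v↔c}) · μ(D ∩ N ∩ ({v↔o} ∪ {o↔c})) ≤ μ(D ∩ {v↔c} ∩ {v↔o}) · μ(D ∩ N)`.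

Proof.  Put `F = {u ↮ v} ∩ {u ↮ c}` (`C_u` avoids `{v, c}`) and consider the two `u`-free events
`E₁ = {c ↔ v} ∩ {c ↮ u}` and `E₂ = ({v ↔ o} ∩ {v ↮ u}) ∪ ({c ↔ o} ∩ {c ↮ u})` ("`o` is joined to `{v, c}` off `C̄_u`").
Read off the pair `(C_u, ω ∖ C̄_u)` (`OffCluster.openConn_inter_compl_eq`), both are decreasing in `C_u` and increasing in
the configuration off `C̄_u`, hence positively correlated given `F` by the off-cluster association engine (event form
`OffCluster.offCluster_event_posAssoc` = van den Berg–Häggström–Kahn, Thm. 1.5 with Thm. 1.3):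
`μ(F ∩ E₁) · μ(F ∩ E₂) ≤ μ(F) · μ(F ∩ E₁ ∩ E₂)`.  Now `F ∩ E₁ = D ∩ {v↔c}`, `F ∩ E₁ ∩ E₂ = D ∩ {v↔c} ∩ {v↔o}`
(given `c ↔ v`, `o ↔ c` is `o ↔ v`), and splitting `μ(F ∩ E₂) = μ(D ∩ N ∩ ({v↔o} ∪ {o↔c})) + μ(D ∩ {v↔c} ∩ {v↔o})`,
`μ(F) = μ(D ∩ {v↔c}) + μ(D ∩ N)` along `E₁`, the cross terms cancel and (3PT-f) remains.  The degenerate cases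
`u = v`, `u = c` read `0 ≤ RHS` (`D ∩ {v↔c} = ∅`).
[cite: VandenbergHaggstromKahn2005, Thm. 1.3 (p. 6), Thm. 1.5 (p. 7), proof pp. 7–8 — corollary]
-/

namespace Summit.CriticalPhenomena.PercolationContinuityZ3.Cruxes.AdditiveGluing.TieLine

open MeasureTheory Set Literature.Probability.LatticeModels Literature.Probability.Percolation
open Literature.Probability.Percolation.BHK2006 (openGraph_le)

noncomputable section

namespace AttachLowerBound

variable {n : ℕ}

/-! ### The engine instance (`s = u`, `X = {v, c}`, events `E₁`, `E₂`) -/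

/-- Off-cluster association, event form, for `F = {C_u ∩ {v, c} = ∅}` and the two `u`-free events
`E₁ = {c ↔ v} ∩ {c ↮ u}`, `E₂ = ({v ↔ o} ∩ {v ↮ u}) ∪ ({c ↔ o} ∩ {c ↮ u})` (both decreasing in `C_u`, increasing off
`C̄_u`):  `μ(F ∩ E₁) · μ(F ∩ E₂) ≤ μ(F) · μ(F ∩ (E₁ ∩ E₂))`.
[cite: VandenbergHaggstromKahn2005, Thm. 1.3 (p. 6), Thm. 1.5 (p. 7), proof pp. 7–8 — corollary] -/
theorem assoc (w : Sym2 (Fin n) → unitInterval) {u v c : Fin n} (hu : u ∉ ({v, c} : Set (Fin n))) (o : Fin n) :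
    (prodBernoulli w).real ({ω : BondConfig (Fin n) | ∀ x ∈ ({v, c} : Set (Fin n)), ¬ (openGraph ω).Reachable u x} ∩
        (openConn c v ∩ (openConn c u)ᶜ)) *
      (prodBernoulli w).real ({ω : BondConfig (Fin n) | ∀ x ∈ ({v, c} : Set (Fin n)), ¬ (openGraph ω).Reachable u x} ∩
        ((openConn v o ∩ (openConn v u)ᶜ) ∪ (openConn c o ∩ (openConn c u)ᶜ))) ≤
    (prodBernoulli w).real {ω : BondConfig (Fin n) | ∀ x ∈ ({v, c} : Set (Fin n)), ¬ (openGraph ω).Reachable u x} *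
      (prodBernoulli w).real ({ω : BondConfig (Fin n) | ∀ x ∈ ({v, c} : Set (Fin n)), ¬ (openGraph ω).Reachable u x} ∩
        ((openConn c v ∩ (openConn c u)ᶜ) ∩ ((openConn v o ∩ (openConn v u)ᶜ) ∪ (openConn c o ∩ (openConn c u)ᶜ)))) := by
  rw [OffCluster.openConn_inter_compl_eq u c v, OffCluster.openConn_inter_compl_eq u v o,
    OffCluster.openConn_inter_compl_eq u c o]
  exact OffCluster.offCluster_event_posAssoc w u ({v, c} : Set (Fin n)) hu
    (fun C E => (openGraph E).Reachable c v ∧ ¬ (c = u ∨ ∃ e ∈ C, c ∈ e))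
    (fun C E => ((openGraph E).Reachable v o ∧ ¬ (v = u ∨ ∃ e ∈ C, v ∈ e)) ∨
      ((openGraph E).Reachable c o ∧ ¬ (c = u ∨ ∃ e ∈ C, c ∈ e)))
    (fun _ _ _ hCC' h => ⟨h.1, fun h' => h.2 (h'.imp id fun ⟨e, he, hxe⟩ => ⟨e, hCC' he, hxe⟩)⟩)
    (fun _ _ _ hEE' h => ⟨h.1.mono (openGraph_le hEE'), h.2⟩)
    (fun _ _ _ hCC' h => h.imp
      (fun h => ⟨h.1, fun h' => h.2 (h'.imp id fun ⟨e, he, hxe⟩ => ⟨e, hCC' he, hxe⟩)⟩)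
      (fun h => ⟨h.1, fun h' => h.2 (h'.imp id fun ⟨e, he, hxe⟩ => ⟨e, hCC' he, hxe⟩)⟩))
    (fun _ _ _ hEE' h => h.imp (fun h => ⟨h.1.mono (openGraph_le hEE'), h.2⟩)
      (fun h => ⟨h.1.mono (openGraph_le hEE'), h.2⟩))

/-! ### Set identities -/

/-- `F ∩ (E₁ ∩ E₂) = D ∩ {v↔c} ∩ {v↔o}` (given `c ↔ v`, `o ↔ c` is `o ↔ v`; `u ↮ v ↔ c` forces `u ↮ c`). [folklore] -/
theorem F_E₁E₂_eq (o u v c : Fin n) :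
    ({ω : BondConfig (Fin n) | ∀ x ∈ ({v, c} : Set (Fin n)), ¬ (openGraph ω).Reachable u x} ∩
        ((openConn c v ∩ (openConn c u)ᶜ) ∩ ((openConn v o ∩ (openConn v u)ᶜ) ∪ (openConn c o ∩ (openConn c u)ᶜ))) :
          Set (BondConfig (Fin n))) = (openConn u v)ᶜ ∩ openConn v c ∩ openConn v o := by
  ext ω
  simp only [mem_inter_iff, mem_union, mem_compl_iff, mem_setOf_eq, mem_insert_iff, mem_singleton_iff,
    forall_eq_or_imp, forall_eq, openConn]
  constructor
  · rintro ⟨⟨huv, -⟩, ⟨hcv, -⟩, h⟩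
    refine ⟨⟨huv, hcv.symm⟩, ?_⟩
    rcases h with ⟨hvo, -⟩ | ⟨hco, -⟩
    exacts [hvo, hcv.symm.trans hco]
  · rintro ⟨⟨huv, hvc⟩, hvo⟩
    have hcu : ¬ (openGraph ω).Reachable c u := fun hcu => huv (hcu.symm.trans hvc.symm)
    exact ⟨⟨huv, fun huc => hcu huc.symm⟩, ⟨hvc.symm, hcu⟩, Or.inl ⟨hvo, fun hvu => huv hvu.symm⟩⟩

/-- `F ∩ E₂ ∩ E₁ᶜ = D ∩ N ∩ ({v↔o} ∪ {o↔c})` (on `F`, `E₁ᶜ` is `c ↮ v`). [folklore] -/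
theorem F_E₂_notE₁_eq (o u v c : Fin n) :
    ({ω : BondConfig (Fin n) | ∀ x ∈ ({v, c} : Set (Fin n)), ¬ (openGraph ω).Reachable u x} ∩
        ((openConn v o ∩ (openConn v u)ᶜ) ∪ (openConn c o ∩ (openConn c u)ᶜ)) ∩ (openConn c v ∩ (openConn c u)ᶜ)ᶜ :
          Set (BondConfig (Fin n))) =
      (openConn u v)ᶜ ∩ ((openConn c u)ᶜ ∩ (openConn c v)ᶜ) ∩ (openConn v o ∪ openConn o c) := by
  ext ω
  simp only [mem_inter_iff, mem_union, mem_compl_iff, mem_setOf_eq, mem_insert_iff, mem_singleton_iff,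
    forall_eq_or_imp, forall_eq, openConn]
  constructor
  · rintro ⟨⟨⟨huv, huc⟩, h⟩, hE⟩
    have hcu : ¬ (openGraph ω).Reachable c u := fun hcu => huc hcu.symm
    refine ⟨⟨huv, hcu, fun hcv => hE ⟨hcv, hcu⟩⟩, ?_⟩
    rcases h with ⟨hvo, -⟩ | ⟨hco, -⟩
    exacts [Or.inl hvo, Or.inr hco.symm]
  · rintro ⟨⟨huv, hcu, hcv⟩, h⟩
    refine ⟨⟨⟨huv, fun huc => hcu huc.symm⟩, ?_⟩, fun hE => hcv hE.1⟩
    rcases h with hvo | hoc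
    exacts [Or.inl ⟨hvo, fun hvu => huv hvu.symm⟩, Or.inr ⟨hoc.symm, hcu⟩]

/-- `F ∩ E₂ ∩ E₁ = D ∩ {v↔c} ∩ {v↔o}`. [folklore] -/
theorem F_E₂_E₁_eq (o u v c : Fin n) :
    ({ω : BondConfig (Fin n) | ∀ x ∈ ({v, c} : Set (Fin n)), ¬ (openGraph ω).Reachable u x} ∩
        ((openConn v o ∩ (openConn v u)ᶜ) ∪ (openConn c o ∩ (openConn c u)ᶜ)) ∩ (openConn c v ∩ (openConn c u)ᶜ) :
          Set (BondConfig (Fin n))) = (openConn u v)ᶜ ∩ openConn v c ∩ openConn v o := by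
  ext ω
  simp only [mem_inter_iff, mem_union, mem_compl_iff, mem_setOf_eq, mem_insert_iff, mem_singleton_iff,
    forall_eq_or_imp, forall_eq, openConn]
  constructor
  · rintro ⟨⟨⟨huv, -⟩, h⟩, hcv, -⟩
    refine ⟨⟨huv, hcv.symm⟩, ?_⟩
    rcases h with ⟨hvo, -⟩ | ⟨hco, -⟩
    exacts [hvo, hcv.symm.trans hco]
  · rintro ⟨⟨huv, hvc⟩, hvo⟩
    have hcu : ¬ (openGraph ω).Reachable c u := fun hcu => huv (hcu.symm.trans hvc.symm)
    exact ⟨⟨⟨huv, fun huc => hcu huc.symm⟩, Or.inl ⟨hvo, fun hvu => huv hvu.symm⟩⟩, hvc.symm, hcu⟩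

/-- `F ∩ E₁ᶜ = D ∩ N` (on `F`, `c ↮ u` holds, so `E₁ᶜ` is `c ↮ v`). [folklore] -/
theorem F_notE₁_eq (u v c : Fin n) :
    ({ω : BondConfig (Fin n) | ∀ x ∈ ({v, c} : Set (Fin n)), ¬ (openGraph ω).Reachable u x} ∩
        (openConn c v ∩ (openConn c u)ᶜ)ᶜ : Set (BondConfig (Fin n))) =
      (openConn u v)ᶜ ∩ ((openConn c u)ᶜ ∩ (openConn c v)ᶜ) := by
  ext ω
  simp only [mem_inter_iff, mem_compl_iff, mem_setOf_eq, mem_insert_iff, mem_singleton_iff, forall_eq_or_imp,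
    forall_eq, openConn]
  constructor
  · rintro ⟨⟨huv, huc⟩, hE⟩
    have hcu : ¬ (openGraph ω).Reachable c u := fun hcu => huc hcu.symm
    exact ⟨huv, hcu, fun hcv => hE ⟨hcv, hcu⟩⟩
  · rintro ⟨huv, hcu, hcv⟩
    exact ⟨⟨huv, fun huc => hcu huc.symm⟩, fun hE => hcv hE.1⟩

/-- Degenerate case `u ∈ {v, c}`: `D ∩ {v↔c} = ∅` (`u ↮ u`, resp. `c ↮ v ↔ c`, is absurd). [folklore] -/
theorem notConn_vc_eq_empty {u v c : Fin n} (hu : u ∈ ({v, c} : Set (Fin n))) :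
    ((openConn u v)ᶜ ∩ openConn v c : Set (BondConfig (Fin n))) = ∅ := by
  refine Set.eq_empty_of_forall_notMem fun ω hω => ?_
  simp only [mem_inter_iff, mem_compl_iff, openConn, mem_setOf_eq] at hω
  obtain ⟨huv, hvc⟩ := hω
  simp only [mem_insert_iff, mem_singleton_iff] at hu
  rcases hu with rfl | rfl
  · exact huv (SimpleGraph.Reachable.refl _)
  · exact huv hvc.symm

/-! ### Measure splits -/

/-- `μ(S ∩ T) + μ(S ∩ Tᶜ) = μ(S)` for the (finite, discrete) product measure. [folklore] -/
theorem real_inter_add (w : Sym2 (Fin n) → unitInterval) (S T : Set (BondConfig (Fin n))) :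
    (prodBernoulli w).real (S ∩ T) + (prodBernoulli w).real (S ∩ Tᶜ) = (prodBernoulli w).real S := by
  rw [← Set.sdiff_eq]
  exact measureReal_inter_add_sdiff (Set.toFinite _).measurableSet

/-- `μ(F ∩ E₁) = μ(D ∩ {v↔c})` (`F ∩ E₁ = D ∩ {v↔c}`: `v ↔ c` and `u ↮ v` force `u ↮ c`). [folklore] -/
theorem real_F_E₁ (w : Sym2 (Fin n) → unitInterval) (u v c : Fin n) :
    (prodBernoulli w).real ({ω : BondConfig (Fin n) | ∀ x ∈ ({v, c} : Set (Fin n)), ¬ (openGraph ω).Reachable u x} ∩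
        (openConn c v ∩ (openConn c u)ᶜ)) =
      (prodBernoulli w).real ((openConn u v)ᶜ ∩ openConn v c : Set (BondConfig (Fin n))) := by
  congr 1
  ext ω
  simp only [mem_inter_iff, mem_compl_iff, mem_setOf_eq, mem_insert_iff, mem_singleton_iff, forall_eq_or_imp,
    forall_eq, openConn]
  constructor
  · rintro ⟨⟨huv, -⟩, hcv, -⟩
    exact ⟨huv, hcv.symm⟩
  · rintro ⟨huv, hvc⟩
    exact ⟨⟨huv, fun huc => huv (huc.trans hvc.symm)⟩, hvc.symm, fun hcu => huv (hcu.symm.trans hvc.symm)⟩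

/-- `μ(F ∩ E₂) = μ(D ∩ N ∩ ({v↔o} ∪ {o↔c})) + μ(D ∩ {v↔c} ∩ {v↔o})` (split along `E₁`). [folklore] -/
theorem real_F_E₂ (w : Sym2 (Fin n) → unitInterval) (o u v c : Fin n) :
    (prodBernoulli w).real ({ω : BondConfig (Fin n) | ∀ x ∈ ({v, c} : Set (Fin n)), ¬ (openGraph ω).Reachable u x} ∩
        ((openConn v o ∩ (openConn v u)ᶜ) ∪ (openConn c o ∩ (openConn c u)ᶜ))) =
      (prodBernoulli w).real ((openConn u v)ᶜ ∩ ((openConn c u)ᶜ ∩ (openConn c v)ᶜ) ∩ (openConn v o ∪ openConn o c) :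
          Set (BondConfig (Fin n))) +
        (prodBernoulli w).real ((openConn u v)ᶜ ∩ openConn v c ∩ openConn v o : Set (BondConfig (Fin n))) := by
  rw [← F_E₂_notE₁_eq o u v c, ← F_E₂_E₁_eq o u v c, add_comm]
  exact (real_inter_add w _ _).symm

/-- `μ(F) = μ(D ∩ {v↔c}) + μ(D ∩ N)` (split along `E₁`). [folklore] -/
theorem real_F (w : Sym2 (Fin n) → unitInterval) (u v c : Fin n) :
    (prodBernoulli w).real {ω : BondConfig (Fin n) | ∀ x ∈ ({v, c} : Set (Fin n)), ¬ (openGraph ω).Reachable u x} =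
      (prodBernoulli w).real ((openConn u v)ᶜ ∩ openConn v c : Set (BondConfig (Fin n))) +
        (prodBernoulli w).real ((openConn u v)ᶜ ∩ ((openConn c u)ᶜ ∩ (openConn c v)ᶜ) : Set (BondConfig (Fin n))) := by
  rw [← real_F_E₁ w u v c, ← F_notE₁_eq u v c]
  exact (real_inter_add w _ _).symm

end AttachLowerBound

open AttachLowerBound in
/-- **Attaching `c`'s cluster to `L` (3PT-f)** (line `tieline`, crux `AdditiveGluing`; lead c11): with `D = {u ↮ v}`,
`N = {c ↮ u} ∩ {c ↮ v}`:  `μ(D ∩ {v↔c}) · μ(D ∩ N ∩ ({v↔o} ∪ {o↔c})) ≤ μ(D ∩ {v↔c} ∩ {v↔o}) · μ(D ∩ N)`, i.e.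
`P_D(o ∈ C_v | c ∈ C_v) ≥ P_D(o ∈ C_v ∪ C_c | c free)`.  It is the positive correlation, given `C_u ∩ {v, c} = ∅`, of
the two `u`-free events `{c ↔ v}` and `{o ↔ v} ∪ {o ↔ c}` read off the configuration off `C̄_u` (event form
`OffCluster.offCluster_event_posAssoc` of the off-cluster association engine = van den Berg–Häggström–Kahn Thm. 1.5/1.3),
after splitting along `{c ↔ v}`.
[cite: VandenbergHaggstromKahn2005, Thm. 1.3 (p. 6), Thm. 1.5 (p. 7), proof pp. 7–8 — corollary] -/
theorem attach_lowerBound : ∀ (n : ℕ) (w : Sym2 (Fin n) → unitInterval) (o u v c : Fin n),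
    (Literature.Probability.LatticeModels.prodBernoulli w).real ((Literature.Probability.Percolation.openConn u v)ᶜ ∩ Literature.Probability.Percolation.openConn v c) *
      (Literature.Probability.LatticeModels.prodBernoulli w).real ((Literature.Probability.Percolation.openConn u v)ᶜ ∩ ((Literature.Probability.Percolation.openConn c u)ᶜ ∩ (Literature.Probability.Percolation.openConn c v)ᶜ) ∩ (Literature.Probability.Percolation.openConn v o ∪ Literature.Probability.Percolation.openConn o c))
    ≤ (Literature.Probability.LatticeModels.prodBernoulli w).real ((Literature.Probability.Percolation.openConn u v)ᶜ ∩ Literature.Probability.Percolation.openConn v c ∩ Literature.Probability.Percolation.openConn v o) *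
      (Literature.Probability.LatticeModels.prodBernoulli w).real ((Literature.Probability.Percolation.openConn u v)ᶜ ∩ ((Literature.Probability.Percolation.openConn c u)ᶜ ∩ (Literature.Probability.Percolation.openConn c v)ᶜ) : Set (Literature.Probability.Percolation.BondConfig (Fin n))) := by
  intro n w o u v c
  by_cases hu : u ∈ ({v, c} : Set (Fin n))
  · -- degenerate: the first factor on the left vanishes
    rw [notConn_vc_eq_empty hu, measureReal_empty, zero_mul]
    exact mul_nonneg measureReal_nonneg measureReal_nonneg
  · -- the engine instance, rewritten along the set identities and the two splits
    have key := assoc w hu o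
    rw [real_F_E₂, F_E₁E₂_eq, real_F, real_F_E₁] at key
    linear_combination key

end

end Summit.CriticalPhenomena.PercolationContinuityZ3.Cruxes.AdditiveGluing.TieLine
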